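import Summits.HodgeConjecture.HodgeConjecture.Theses.PeriodDeficiency
import Literature.AlgebraicGeometry.HodgeTheory.HodgeLocus
import Literature.AlgebraicGeometry.HodgeTheory.HodgeGenericQbarDescentProofs
import Literature.AlgebraicGeometry.HodgeTheory.CountableGaloisOrbitDescent
import Literature.AlgebraicGeometry.Motives.AtypicalHodgeLocus
import Literature.AlgebraicGeometry.Motives.BaseChange
import HarnessLib

/-!
# Route PeriodDeficiency — `QbarGenericIsHodgeGeneric` (stmt-HodgeConjecture-11595), line `registered`: stub `stub_countableOrbit_definedOverQbar`

The registered stub `stub_countableOrbit_definedOverQbar` (stub (v) of reshape r2, "countable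
Galois orbit ⟹ defined over `ℚ̄`") of the line skeleton
`Cruxes/QbarGenericIsHodgeGeneric/Lines/birth.lean`, proved UNCONDITIONALLY.

**Statement.** For `σ : ℚ̄ →+* ℂ` and a `ℚ̄`-scheme `S₀`, put `S = S₀ ⊗_σ ℂ`. An irreducible
Zariski-closed set `Y ⊆ S(ℂ)` of complex points (`IsIrreducibleZariskiClosedOnPoints`) whose orbit
`{τ · Y | τ ∈ Aut(ℂ/ℚ̄)}` under Galois conjugation (`HodgeTheory.conjPoint`) is countable is defined
over `ℚ̄` (`HodgeTheory.IsDefinedOverQbar`: Zariski closed and stable under every `τ`). The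
hypotheses `IrreducibleSpace S₀.left` and `Smooth S₀.hom` of the registered signature are not used
(no finiteness or separatedness of `S₀` is needed either).

**Proof.** Let `T = pt '' Y ⊆ S` (irreducible: continuous image of the irreducible `Y`) and `η` the
generic point of `closure T` (schemes are sober); `Y = pt⁻¹(closure T)` since `Y` is the preimage
of some closed set. For `τ ∈ Aut(ℂ/ℚ̄)` the conjugation `τ⁻¹ · —` of `S(ℂ)` covers the scheme
endomorphism `ψ_τ = 𝟙 ×_ℚ̄ Spec τ` of `S = S₀ ×_ℚ̄ Spec ℂ` (`HodgeTheory.pt_conjPoint_eq`), so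
`pt '' (τ⁻¹ · Y) = ψ_τ '' T` has generic point `ψ_τ(η)`; generic points being unique (schemes are
`T₀`), `τ ↦ ψ_τ(η)` factors through the countable orbit of `Y`. By
`HodgeTheory.twist_apply_eq_self_of_countable` (Literature, `CountableGaloisOrbitDescent`: on an
affine chart `Spec (ℂ ⊗_ℚ̄ R) ∋ η` the twists are `Spec (τ ⊗ id)`, the prime `η` has countable
orbit, and in coordinates an ideal / subspace with countable `Aut(ℂ/ℚ̄)`-orbit is stable — the
smallest-field-of-definition mechanism of Lang III §2 Thm. 7, using that `Aut(ℂ/ℚ̄)` is transitive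
on the uncountable set of transcendentals) every `ψ_τ` fixes `η`. Finally, for `P ∈ Y`,
`η ⤳ P.pt` gives `η = ψ_{τ⁻¹}(η) ⤳ ψ_{τ⁻¹}(P.pt) = (τ · P).pt`, i.e. `τ · P ∈ Y`.

## References

* S. Lang, *Introduction to Algebraic Geometry* (1958), Ch. III §2 Thm. 7, §4–§5. [Lang1958IAG]
* C. Voisin, *Hodge loci and absolute Hodge classes*, Compos. Math. 143 (2007), §1, Thm. 0.5 (2).
  [Voisin2007HodgeLoci]
* F. Charles, C. Schnell, *Notes on absolute Hodge classes* (2014), §11.3. [CharlesSchnell2014Notes]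
-/

-- every declaration of this problem lives in `Summit.HodgeConjecture.HodgeConjecture.…`
set_option linter.dupNamespace false

noncomputable section

namespace Summit.HodgeConjecture.HodgeConjecture.Theorems

open CategoryTheory CategoryTheory.Limits AlgebraicGeometry
open Literature.AlgebraicGeometry.Motives Literature.AlgebraicGeometry.HodgeTheory

/-! ### Assembly over `ℚ̄ ⊆ ℂ`: the registered stub -/

section Stub

/-- **An irreducible Zariski-closed set of complex points of `S₀ ⊗_σ ℂ` with countable
`Aut(ℂ/ℚ̄)`-orbit is stable under `Aut(ℂ/ℚ̄)`-conjugation** — the key claim behind the registered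
stub: with `C = closure (pt '' Y)` (irreducible closed in the scheme `S = S₀ ×_ℚ̄ Spec ℂ`, generic
point `η`, `Y = pt⁻¹ C`), the generic point of `closure (pt '' (τ⁻¹ · Y))` is `ψ_τ(η)` for the
twist `ψ_τ = 𝟙 × Spec τ` (`HodgeTheory.pt_conjPoint_eq`), so `τ ↦ ψ_τ(η)` takes countably many
values and `twist_apply_eq_self_of_countable` gives `ψ_τ(η) = η`, whence `τ · Y ⊆ Y` by
specialisation. Mechanism: the smallest field of definition `k₀` of an ideal / a closed set
(`𝔞^τ = 𝔞 ⟺ τ|k₀ = id`, Lang III §2 Thm. 7; Weil; EGA IV₂ 4.8.11–13) — if `k₀ ≠ ℚ̄` it contains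
a transcendental and the orbit is uncountable. This is the countability argument by which
components of Hodge loci of absolute classes are shown to be defined over `ℚ̄` (Voisin 2007, §1;
Charles–Schnell 2014, §11.3). [cite: Lang1958IAG, Ch. III §2, Thm. 7] -/
theorem image_conjPoint_subset_of_countable_orbit (σ : AlgebraicClosure ℚ →+* ℂ)
    (S₀ : SchemeOver (AlgebraicClosure ℚ)) (Y : Set (ComplexPoints ((baseChangeHom σ).obj S₀)))
    (hY : IsIrreducibleZariskiClosedOnPoints ((baseChangeHom σ).obj S₀) Y)
    (hcount : {Y' : Set (ComplexPoints ((baseChangeHom σ).obj S₀)) |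
      ∃ τ : ringAutOver σ, Y' = conjPoint σ S₀ τ '' Y}.Countable) (τ : ringAutOver σ) :
    conjPoint σ S₀ τ '' Y ⊆ Y := by
  classical
  letI : Algebra (AlgebraicClosure ℚ) ℂ := σ.toAlgebra
  -- the Galois twists `𝟙 × Spec τ` of `S₀ ×_ℚ̄ Spec ℂ`
  have htwist : ∀ τ : ℂ ≃ₐ[AlgebraicClosure ℚ] ℂ,
      Spec.map (CommRingCat.ofHom (algebraMap (AlgebraicClosure ℚ) ℂ)) ≫ 𝟙 _ =
        Spec.map (CommRingCat.ofHom (τ : ℂ →+* ℂ)) ≫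
          Spec.map (CommRingCat.ofHom (algebraMap (AlgebraicClosure ℚ) ℂ)) := by
    intro τ
    rw [Category.comp_id, ← Spec.map_comp, ← CommRingCat.ofHom_comp]
    congr 2
    ext a
    simp
  let ψ : ∀ τ : ℂ ≃ₐ[AlgebraicClosure ℚ] ℂ,
      pullback S₀.hom (Spec.map (CommRingCat.ofHom (algebraMap (AlgebraicClosure ℚ) ℂ))) ⟶
        pullback S₀.hom (Spec.map (CommRingCat.ofHom (algebraMap (AlgebraicClosure ℚ) ℂ))) :=
    fun τ => pullback.map _ _ _ _ (𝟙 _) (Spec.map (CommRingCat.ofHom (τ : ℂ →+* ℂ))) (𝟙 _)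
      (by simp) (htwist τ)
  have hψ1 : ∀ τ, ψ τ ≫ pullback.fst _ _ = pullback.fst _ _ := fun τ =>
    (pullback.lift_fst _ _ _).trans (Category.comp_id _)
  have hψ2 : ∀ τ, ψ τ ≫ pullback.snd _ _ =
      pullback.snd _ _ ≫ Spec.map (CommRingCat.ofHom (τ : ℂ →+* ℂ)) := fun τ =>
    pullback.lift_snd _ _ _
  -- conjugation on scheme points: `(τ⁻¹ · P).pt = ψ_τ (P.pt)`
  have hpt : ∀ (τ : ℂ ≃ₐ[AlgebraicClosure ℚ] ℂ) (P : ComplexPoints ((baseChangeHom σ).obj S₀)),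
      (conjPoint σ S₀ τ.symm P).pt = ψ τ P.pt := fun τ P =>
    pt_conjPoint_eq σ S₀ τ.symm P (ψ τ) (hψ1 τ) (by simpa using hψ2 τ)
  -- the irreducible set `T = pt '' Y` of scheme points and its generic point `η`
  set T : Set ↥(pullback S₀.hom
      (Spec.map (CommRingCat.ofHom (algebraMap (AlgebraicClosure ℚ) ℂ)))) :=
    (fun P : ComplexPoints ((baseChangeHom σ).obj S₀) => P.pt) '' Y with hTdef
  have hTirr : IsIrreducible T := by
    have hq : Continuous fun P : ZariskiPoints ((baseChangeHom σ).obj S₀) ℂ => P.val.pt :=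
      continuous_induced_dom
    have himg : (fun P : ZariskiPoints ((baseChangeHom σ).obj S₀) ℂ => P.val.pt) ''
        zariskiSet ((baseChangeHom σ).obj S₀) Y = T := by
      ext x
      constructor
      · rintro ⟨P, hP, rfl⟩
        exact ⟨P.val, hP, rfl⟩
      · rintro ⟨P, hP, rfl⟩
        exact ⟨(show ZariskiPoints ((baseChangeHom σ).obj S₀) ℂ from P), hP, rfl⟩
    rw [← himg]
    exact hY.2.image _ hq.continuousOn
  set η := hTirr.genericPoint with hηdef
  have hη : IsGenericPoint η (closure T) := hTirr.isGenericPoint_genericPoint_closure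
  -- `Y = pt⁻¹ (closure T)`
  have hYC : ∀ P : ComplexPoints ((baseChangeHom σ).obj S₀), P ∈ Y ↔ P.pt ∈ closure T := by
    obtain ⟨Z, hZ, hZY⟩ := isClosed_induced_iff.1 hY.1
    have hmem : ∀ P : ComplexPoints ((baseChangeHom σ).obj S₀), P ∈ Y ↔ P.pt ∈ Z := fun P =>
      (Set.ext_iff.1 hZY (show ZariskiPoints ((baseChangeHom σ).obj S₀) ℂ from P)).symm
    have hTZ : closure T ⊆ Z := by
      refine closure_minimal ?_ hZ
      rintro _ ⟨P, hP, rfl⟩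
      exact (hmem P).1 hP
    intro P
    constructor
    · intro hP
      exact subset_closure ⟨P, hP, rfl⟩
    · intro hP
      exact (hmem P).2 (hTZ hP)
  -- the generic point of the conjugate `τ⁻¹ · Y` is `ψ_τ η`
  have hgen : ∀ τ : ℂ ≃ₐ[AlgebraicClosure ℚ] ℂ, IsGenericPoint (ψ τ η)
      (closure ((fun P : ComplexPoints ((baseChangeHom σ).obj S₀) => P.pt) ''
        (conjPoint σ S₀ τ.symm '' Y))) := by
    intro τ
    -- (stated with the twist on the left so that both sides live over the fibre product)
    have himg : ψ τ '' T = (fun P : ComplexPoints ((baseChangeHom σ).obj S₀) => P.pt) ''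
        (conjPoint σ S₀ τ.symm '' Y) := by
      rw [hTdef, Set.image_image, Set.image_image]
      exact Set.image_congr fun P _ => (hpt τ P).symm
    have h := hη.image (ψ τ).continuous
    rw [closure_image_closure (ψ τ).continuous, isGenericPoint_def] at h
    exact h.trans (congrArg closure himg)
  -- hence the orbit of `η` under the twists is countable
  have hcountη : (Set.range fun τ : ℂ ≃ₐ[AlgebraicClosure ℚ] ℂ => ψ τ η).Countable := by
    let F : Set (ComplexPoints ((baseChangeHom σ).obj S₀)) →
        ↥(pullback S₀.hom (Spec.map (CommRingCat.ofHom (algebraMap (AlgebraicClosure ℚ) ℂ)))) :=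
      fun Y' => if h : ∃ x, IsGenericPoint x
          (closure ((fun P : ComplexPoints ((baseChangeHom σ).obj S₀) => P.pt) '' Y'))
        then h.choose else η
    refine (hcount.image F).mono ?_
    rintro _ ⟨τ, rfl⟩
    refine ⟨conjPoint σ S₀ τ.symm '' Y, ⟨τ.symm, rfl⟩, ?_⟩
    have h : ∃ x, IsGenericPoint x
        (closure ((fun P : ComplexPoints ((baseChangeHom σ).obj S₀) => P.pt) ''
          (conjPoint σ S₀ τ.symm '' Y))) := ⟨_, hgen τ⟩
    show (if h : ∃ x, IsGenericPoint x
        (closure ((fun P : ComplexPoints ((baseChangeHom σ).obj S₀) => P.pt) ''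
          (conjPoint σ S₀ τ.symm '' Y))) then h.choose else η) = ψ τ η
    rw [dif_pos h]
    exact h.choose_spec.eq (hgen τ)
  -- all twists fix `η`
  have hfix : ∀ τ : ℂ ≃ₐ[AlgebraicClosure ℚ] ℂ, ψ τ η = η :=
    twist_apply_eq_self_of_countable
      (fun c c' hc hc' => exists_algEquiv_apply_eq_of_not_mem_range_qbar σ hc hc')
      (not_countable_compl_range_qbar σ) S₀ ψ hψ1 hψ2 η hcountη
  -- conclusion: `τ · Y ⊆ Y`
  rintro _ ⟨P, hP, rfl⟩
  rw [hYC] at hP ⊢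
  have h1 : (conjPoint σ S₀ τ P).pt = ψ τ.symm P.pt := by
    have h := hpt τ.symm P
    simpa using h
  rw [h1]
  have hspec : ψ τ.symm η ⤳ ψ τ.symm P.pt := (hη.specializes hP).map (ψ τ.symm).continuous
  rw [hfix] at hspec
  exact hη.specializes_iff_mem.1 hspec

/-- **A Zariski-closed irreducible set of complex points stable under `Aut(ℂ/ℚ̄)` is defined over
`ℚ̄`** (the form in which `IsDefinedOverQbar` is established). [cite: Lang1958IAG, Ch. III §5, C4–C7] -/
theorem isDefinedOverQbar_of_image_conjPoint_subset {σ : AlgebraicClosure ℚ →+* ℂ}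
    {S₀ : SchemeOver (AlgebraicClosure ℚ)} {Y : Set (ComplexPoints ((baseChangeHom σ).obj S₀))}
    (hY : IsIrreducibleZariskiClosedOnPoints ((baseChangeHom σ).obj S₀) Y)
    (hstab : ∀ τ : ringAutOver σ, conjPoint σ S₀ τ '' Y ⊆ Y) :
    IsDefinedOverQbar σ S₀ Y :=
  ⟨(isZariskiClosedOnPoints_iff_isClosed _).2 hY.1, fun τ _ => hstab τ⟩

/-! ### The registered stub of the crux skeleton (reshape r2) -/

/-- **Registered stub `stub_countableOrbit_definedOverQbar` of the crux skeleton
`QbarGenericIsHodgeGeneric` (line `registered`, reshape r2):** for a `ℚ̄`-scheme `S₀` (the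
smoothness and irreducibility hypotheses of the skeleton are not needed), an irreducible
Zariski-closed set `Y` of complex points of `S₀ ⊗_σ ℂ` whose orbit under `Aut(ℂ/ℚ̄)` is countable
is defined over `ℚ̄` — the countability argument for fields of definition (a closed set with only
countably many `Aut(ℂ/ℚ̄)`-translates is `ℚ̄`-closed), via the smallest field of definition of an
ideal (`𝔞^τ = 𝔞 ⟺ τ` fixes it pointwise: Lang III §2 Thm. 7; Weil; EGA IV₂ 4.8.11–13), here in the
canonical-form version `image_conjPoint_subset_of_countable_orbit`. [cite: Lang1958IAG, Ch. III §2, Thm. 7] -/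
theorem stub_countableOrbit_definedOverQbar :
    ∀ (σ : AlgebraicClosure ℚ →+* ℂ) ⦃S₀ : SchemeOver (AlgebraicClosure ℚ)⦄,
      IrreducibleSpace S₀.left → AlgebraicGeometry.Smooth S₀.hom →
      ∀ Y : Set (ComplexPoints ((baseChangeHom σ).obj S₀)),
        IsIrreducibleZariskiClosedOnPoints ((baseChangeHom σ).obj S₀) Y →
        {Y' : Set (ComplexPoints ((baseChangeHom σ).obj S₀)) |
            ∃ τ : ringAutOver σ, Y' = conjPoint σ S₀ τ '' Y}.Countable →
        IsDefinedOverQbar σ S₀ Y :=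
  fun σ S₀ _ _ Y hY hcount =>
    isDefinedOverQbar_of_image_conjPoint_subset hY
      (image_conjPoint_subset_of_countable_orbit σ S₀ Y hY hcount)

end Stub

end Summit.HodgeConjecture.HodgeConjecture.Theorems

end
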